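import Summits.AtomisticToContinuum.FouriersLaw.Theorems.JunctionLocalityDefs
import Summits.AtomisticToContinuum.FouriersLaw.Theorems.JunctionLocalityNonBallisticStubLightConeWindowAux1
import Summits.AtomisticToContinuum.FouriersLaw.Theorems.JunctionLocalityNonBallisticStubLightConeWindowAux2
import Summits.AtomisticToContinuum.FouriersLaw.Theorems.JunctionLocalityNonBallisticStubLightConeWindowAux4
import Summits.AtomisticToContinuum.FouriersLaw.Theorems.BondHeatUncertaintyLightConeBondHeatBondCorrelation

/-!
# Stub `stub_lightConeWindow` (LC) of line `contact-current-forgetting` — status and reduction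

STATUS (stub worker, 2026-08-16). The registered stub

  `theorem stub_lightConeWindow : ∀ ω₂ lam β γ : ℝ, 0 < ω₂ → 0 < lam → 0 < β → 0 < γ → ∀ T : ℝ, 0 < T →
      ∃ t₀ η : ℕ → ℝ, (∀ N, 0 ≤ t₀ N) ∧ Tendsto t₀ atTop atTop ∧ Tendsto (fun N => η N * t₀ N) atTop (𝓝 0) ∧
        ∀ N : ℕ, 2 ≤ N → ∀ t : ℝ, 0 ≤ t → t ≤ t₀ N → |gkEntry (pinnedChain ω₂ lam β γ) N T 0 (N - 2) t| ≤ η N`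

is NOT closed: its dynamical content — almost-finite propagation speed of the open anharmonic chain with its two
Langevin baths, at thermal equilibrium — is not in the tree (the tree's light cone `ButtaMarchioro2016_thm22_chain_holds`
is for the INFINITE DETERMINISTIC chain, almost surely, via the pathwise Dobrushin–Fritz iteration
`BMLightCone.lattice_iteration*` plus Borel–Cantelli energy control from a time-invariant superstable state; nothing
pathwise of that kind exists for `chainFlow`/`transitionKernel` of the finite chain with baths). What IS proved
(sorry-free, landed as helpers of crux stmt-AtomisticToContinuum-9127):

* `…StubLightConeWindowAux1` (LANDED p86032) — the contact-momenta flip `Θ₀₁ = momentumFlip 0 ∘ momentumFlip 1` preserves `μ_T`,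
  `j₀∘Θ₀₁ = -j₀`, `j_k∘Θ₀₁ = j_k` (`k ≥ 2`); hence `∫ j₀ j_k dμ_T = 0` for `k ≥ 2` (equal-time decorrelation:
  `M_N(0,N-2)(0) = 0` for `N ≥ 4`) and the pairing bound `4(∫ j₀ h dμ_T)² ≤ ∫ j₀² dμ_T · ∫ (h - h∘Θ₀₁)² dμ_T`.
* `…StubLightConeWindowAux2` (LANDED p86457) — `lightConeWindow_of_fixedTimeLocality`: the stub follows VERBATIM from the fixed-time
  locality statement (FTL) below by a diagonal extraction (`exists_window_of_fixedTime`).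
* `…StubLightConeWindowAux4` (proposed, see notes) — `pinnedChain_integral_sq_bondCurrent_zero_le`: the static input (S) below IS PROVED
  (`N`-uniform `∫ j₀² dμ_T ≤ C`: Gaussian integration by parts in `p₀, p₁` + the landed `N`-uniform eighth moments).
* this file (to land as `…StubLightConeWindowAux3`) — `fixedTimeLocality_of_flipInsensitivity`: (FTL) follows from (S)
  and the synchronous-coupling flow-sensitivity statement (FS) below (pairing bound + `L²(μ_T)` bookkeeping), and
  `lightConeWindow_of_flipInsensitivity`: (FS) ALONE ⟹ the stub, verbatim. SO THE STUB IS BLOCKED EXACTLY ON (FS).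

THE MISSING FACTS (exact Lean signatures; `P = pinnedChain ω₂ lam β γ`, `μ_T = P.gibbsMeasure N T`,
`κ_s = P.transitionKernel N T T s`; namespaces/opens as in this file):

(FTL) fixed-time locality of the extreme Green–Kubo entry (⟺ the stub; Defs vocabulary):
  `∀ ω₂ lam β γ : ℝ, 0 < ω₂ → 0 < lam → 0 < β → 0 < γ → ∀ T : ℝ, 0 < T → ∀ tstar ε : ℝ, 0 < ε →
      ∃ N₀ : ℕ, ∀ N : ℕ, N₀ ≤ N → ∀ t : ℝ, 0 ≤ t → t ≤ tstar →
        |gkEntry (pinnedChain ω₂ lam β γ) N T 0 (N - 2) t| ≤ ε`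

(S) `N`-uniform second moment of the contact current (static; tree vocabulary) — PROVED, `…Aux4`
    `pinnedChain_integral_sq_bondCurrent_zero_le`:
  `∀ ω₂ lam β γ : ℝ, 0 < ω₂ → 0 < lam → 0 < β → 0 < γ → ∀ T : ℝ, 0 < T →
      ∃ C : ℝ, ∀ (N : ℕ) (i : Fin N), (i : ℕ) = 0 →
        ∫ x, (pinnedChain ω₂ lam β γ).bondCurrent N i x ^ 2 ∂((pinnedChain ω₂ lam β γ).gibbsMeasure N T) ≤ C`

(FS) flip-insensitivity of the evolved far contact current = almost-finite propagation speed of the open chain with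
    baths, qualitative `L²(μ_T ⊗ Wiener)` form under the synchronous coupling (same noise, initial data `x` vs `Θ₀₁ x`;
    Buttà–Caglioti–Di Ruzza–Marchioro, J. Stat. Phys. 127 (2007) 313, §2; Buttà–Marchioro, J. Stat. Phys. 164 (2016)
    680, Thm 2.2 — printed only for the infinite deterministic chain; NOT in tree):
  `∀ ω₂ lam β γ : ℝ, 0 < ω₂ → 0 < lam → 0 < β → 0 < γ → ∀ T : ℝ, 0 < T → ∀ tstar ε : ℝ, 0 < ε →
      ∃ N₀ : ℕ, ∀ (N : ℕ) (i i' k : Fin N), N₀ ≤ N → (i : ℕ) = 0 → (i' : ℕ) = 1 → (k : ℕ) = N - 2 →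
        ∀ s : NNReal, (s : ℝ) ≤ tstar →
          ∫ x, ((∫ y, (pinnedChain ω₂ lam β γ).bondCurrent N k y ∂((pinnedChain ω₂ lam β γ).transitionKernel N T T s x)) -
              (∫ y, (pinnedChain ω₂ lam β γ).bondCurrent N k y
                ∂((pinnedChain ω₂ lam β γ).transitionKernel N T T s (momentumFlip i (momentumFlip i' x))))) ^ 2
            ∂((pinnedChain ω₂ lam β γ).gibbsMeasure N T) ≤ ε`

ROUTE TO (FS) (not formalised here — size XL glue, but every named ingredient below IS in the tree; note that (FS)
is needed at FIXED `tstar` only, the window `t₀(N) → ∞` being produced by the diagonal extraction of `…Aux2`):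
1. kernel → paths: `κ_s g (x) = E_W[g(solMap x W s)]` (`pinnedChain_transitionKernel_eq_map_solMap`,
   `pinnedChain_integral_transitionKernel`), so by Jensen the integrand of (FS) is
   `≤ E_W[(j_k(z_s(x,W)) - j_k(z_s(Θ₀₁x,W)))²]`: two strong solutions (`chainFlow`, `LangevinChainSDE.lean`) driven by
   the SAME noise path from `x` and `Θ₀₁ x`; both are stationary under `μ_T ⊗ W` (`Θ₀₁` preserves `μ_T`,
   `measurePreserving_contactFlip_gibbsMeasure`; Gibbs invariance `pinnedChain_gibbsMeasure_bind_transitionKernel`).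
2. pathwise comparison (the noise CANCELS in the difference): `u_l := |δq_l| + |δp_l|` obeys
   `u_l(τ) ≤ u_l(0) + a ∫₀^τ (u_{l-1} + u_l + u_{l+1})` with the GLOBAL rate `a = C_P (1 + γ + √H_max)`,
   `H_max := sup_{r ≤ s} (H(z_r) ⊔ H(z̃_r))` — the forces are cubic and `lam q⁴/4, β r⁴/4 ≤ H` make their Lipschitz
   constants `O(√H)` (`pinnedChain_U_le_hamiltonian`, `pinnedChain_bond_le_hamiltonian`); the abstract Dobrushin–Fritz
   scheme `BMLightCone.lattice_iteration_far` (`InfiniteChainLightConeProofs.lean`, `g ≡ 1`; go `x → Θ₀x → Θ₀₁x` to have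
   single-site initial perturbations `2|p₀|`, `2|p₁|`) gives `u_{N-2}(s) + u_{N-1}(s) ≤ 8(|p₀|+|p₁|) 2^{-(N-3)}` as soon
   as `2e·3a·s ≤ N - 3`.
3. crude pathwise energy control suffices at fixed `tstar`: `1 + H(z_r - (0,η_r)) ≤ (1 + H(x)) e^{C M r}`,
   `M = sup_{[0,s]} ‖η‖` — the tree's `pinnedChain_hamiltonian_chainFlow_le` (`LangevinChainFlowBounds.lean`) has this
   shape but with `C = pinnedChainEnergyConst ~ N³` (noise allowed at every site), useless here; for the bath noise
   (supported on the two end sites) the same Grönwall argument gives an `N`-FREE `C`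
   (`DH(y)·Y(y+(0,η)) = Σ_b ∂_{q_b}H η_b - γ Σ_b (p_b² + p_b η_b) ≤ M C_P (1 + H)`, `OscillatorChain.fderiv_hamiltonian_apply`).
   Then on `G := {H(x) ≤ N^{3/2}} ∩ {sup_{[0,tstar]} ‖W‖ ≤ M₀}` the rate is `a = O(N^{3/4})` uniformly in `s ≤ tstar`
   and the light-cone condition holds for `N ≥ N₀(tstar, M₀)`; `μ_T(H > N^{3/2}) → 0` from `∫ e^{ϑH} dμ_T^N ≤ e^{cN}`
   (per-site partition-function bounds, cf. `…GibbsPositionEighthMoment*`), and `P(sup_{[0,tstar]} ‖W‖ > M₀) → 0`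
   (`M₀ → ∞`) is a Wiener maximal inequality.
4. off `G`: `|Δ| ≤ |j_k(z_s)| + |j_k(z̃_s)|`, Hölder with a large exponent and stationarity
   (`E|j_k(z_s)|^{2p} = ∫ |j_k|^{2p} dμ_T ≤ e^{c_p N}` from `|j| ≤ N(3+β)(1+H)²/2`, `pinnedChain_abs_bondCurrent_le`, and the
   exponential Gibbs moment), against `P(Gᶜ)^{1/q}`, which must therefore be made exponentially small in `N` — replace
   `N^{3/2}` by `K N` in `G` and use `μ_T(H > KN) ≤ e^{(c - ϑK)N}`.
Ingredients NOT in tree: the pathwise difference inequality for `chainFlow` (finite-chain analogue of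
`BMLightCone.lc_force_sub_le` / `IsSolution.lc_norm_sub_le_integral`), the `N`-free energy Grönwall bound for bath-site
noise, the `N`-growth bound of `∫ e^{ϑH} dμ_T^N`, the Wiener maximal inequality for `wienerPair`, and the assembly.
-/

noncomputable section

open MeasureTheory ProbabilityTheory Set Filter Topology
open scoped NNReal

namespace Summit.AtomisticToContinuum.FouriersLaw.Theorems.NonBallistic

open Literature.MathematicalPhysics.KineticTheory.HeatConduction
open Summit.AtomisticToContinuum.FouriersLaw.Theorems.JunctionLocality
open Summit.AtomisticToContinuum.FouriersLaw.Theorems.SubdiffusiveBondHeat (pinnedChain_integral_sq_act_le)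
open Summit.AtomisticToContinuum.FouriersLaw.Theorems.LightConeBondHeat (pinnedChain_abs_bondCurrent_le_exp
  quarter_inv_temp_admissible)

/-- **(S) ∧ (FS) ⟹ (FTL).** The `N`-uniform second moment of the contact current and the `L²(μ_T)` flip-insensitivity
of the evolved far contact current give fixed-time locality of the extreme Green–Kubo entry:
`4 M_N(0,N-2)(t)² ≤ ∫ j₀² dμ_T · ∫ (κ_t j_{N-2} - (κ_t j_{N-2})∘Θ₀₁)² dμ_T` (pairing bound of the contact-momenta flip,
`four_mul_sq_integral_bondCurrent_zero_mul_le`; `j₀, κ_t j_{N-2} ∈ L²(μ_T)` by `pinnedChain_integral_sq_act_le`). [folklore] -/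
theorem fixedTimeLocality_of_flipInsensitivity
    (hS : ∀ ω₂ lam β γ : ℝ, 0 < ω₂ → 0 < lam → 0 < β → 0 < γ → ∀ T : ℝ, 0 < T →
      ∃ C : ℝ, ∀ (N : ℕ) (i : Fin N), (i : ℕ) = 0 →
        ∫ x, (pinnedChain ω₂ lam β γ).bondCurrent N i x ^ 2 ∂((pinnedChain ω₂ lam β γ).gibbsMeasure N T) ≤ C)
    (hFS : ∀ ω₂ lam β γ : ℝ, 0 < ω₂ → 0 < lam → 0 < β → 0 < γ → ∀ T : ℝ, 0 < T → ∀ tstar ε : ℝ, 0 < ε →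
      ∃ N₀ : ℕ, ∀ (N : ℕ) (i i' k : Fin N), N₀ ≤ N → (i : ℕ) = 0 → (i' : ℕ) = 1 → (k : ℕ) = N - 2 →
        ∀ s : NNReal, (s : ℝ) ≤ tstar →
          ∫ x, ((∫ y, (pinnedChain ω₂ lam β γ).bondCurrent N k y
                  ∂((pinnedChain ω₂ lam β γ).transitionKernel N T T s x)) -
              (∫ y, (pinnedChain ω₂ lam β γ).bondCurrent N k y
                ∂((pinnedChain ω₂ lam β γ).transitionKernel N T T s (momentumFlip i (momentumFlip i' x))))) ^ 2
            ∂((pinnedChain ω₂ lam β γ).gibbsMeasure N T) ≤ ε) :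
    ∀ ω₂ lam β γ : ℝ, 0 < ω₂ → 0 < lam → 0 < β → 0 < γ → ∀ T : ℝ, 0 < T → ∀ tstar ε : ℝ, 0 < ε →
      ∃ N₀ : ℕ, ∀ N : ℕ, N₀ ≤ N → ∀ t : ℝ, 0 ≤ t → t ≤ tstar →
        |gkEntry (pinnedChain ω₂ lam β γ) N T 0 (N - 2) t| ≤ ε := by
  intro ω₂ lam β γ hω hl hβ hγ T hT tstar ε hε
  set P := pinnedChain ω₂ lam β γ with hP
  obtain ⟨C, hC⟩ := hS ω₂ lam β γ hω hl hβ hγ T hT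
  -- a positive static constant
  set C' : ℝ := max C 1 with hC'
  have hC'0 : 0 < C' := lt_of_lt_of_le one_pos (le_max_right _ _)
  have hε' : 0 < 4 * ε ^ 2 / C' := by positivity
  obtain ⟨N₀, hN₀⟩ := hFS ω₂ lam β γ hω hl hβ hγ T hT tstar (4 * ε ^ 2 / C') hε'
  refine ⟨max N₀ 2, fun N hN t ht0 ht1 => ?_⟩
  have hN₀N : N₀ ≤ N := le_trans (le_max_left _ _) hN
  have hN2 : 2 ≤ N := le_trans (le_max_right _ _) hN
  have hNpos : 0 < N := by omega
  set i : Fin N := ⟨0, hNpos⟩ with hi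
  set i' : Fin N := ⟨1, by omega⟩ with hi'
  set k : Fin N := ⟨N - 2, by omega⟩ with hk
  set μ := P.gibbsMeasure N T with hμ
  set s : ℝ≥0 := t.toNNReal with hs
  set κ := P.transitionKernel N T T s with hκ
  have hst : (s : ℝ) = t := Real.coe_toNNReal _ ht0
  -- the entry in tree vocabulary
  set h : PhaseSpace N → ℝ := fun x => ∫ y, P.bondCurrent N k y ∂(κ x) with hh
  have hentry : gkEntry P N T 0 (N - 2) t = ∫ x, P.bondCurrent N i x * h x ∂μ := by
    rw [gkEntry_def]
    refine integral_congr_ae (Eventually.of_forall fun x => ?_)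
    have hb : bondCurrentAt P N (N - 2) = P.bondCurrent N k := by
      funext y
      rw [bondCurrentAt_eq_bondCurrent P (show N - 2 < N by omega)]
    simp only [bondCurrentAt_eq_bondCurrent P hNpos, evolve_def, hb]
    rfl
  -- `L²(μ_T)` membership of `j₀` and of `κ_t j_{N-2}`
  obtain ⟨hϑ0, h2ϑ⟩ := quarter_inv_temp_admissible hT
  have hji := pinnedChain_integral_sq_act_le hω hl.le hβ hγ hNpos hT hϑ0 h2ϑ
    (pinnedChain_continuous_bondCurrent ω₂ lam β γ N i) (pinnedChain_abs_bondCurrent_le_exp hω.le hl.le hβ.le γ N hϑ0 i) s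
  have hjk := pinnedChain_integral_sq_act_le hω hl.le hβ hγ hNpos hT hϑ0 h2ϑ
    (pinnedChain_continuous_bondCurrent ω₂ lam β γ N k) (pinnedChain_abs_bondCurrent_le_exp hω.le hl.le hβ.le γ N hϑ0 k) s
  have hj2 : MemLp (P.bondCurrent N i) 2 μ :=
    (memLp_two_iff_integrable_sq (pinnedChain_continuous_bondCurrent ω₂ lam β γ N i).aestronglyMeasurable).2 hji.1
  have hhm : StronglyMeasurable h :=
    (pinnedChain_continuous_bondCurrent ω₂ lam β γ N k).stronglyMeasurable.integral_kernel (κ := κ)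
  have hh2 : MemLp h 2 μ := (memLp_two_iff_integrable_sq hhm.aestronglyMeasurable).2 hjk.2.1
  -- the pairing bound and the two hypotheses
  have hpair := four_mul_sq_integral_bondCurrent_zero_mul_le P T i i' rfl rfl hj2 hh2
  have hstat : ∫ x, P.bondCurrent N i x ^ 2 ∂μ ≤ C' := (hC N i rfl).trans (le_max_left _ _)
  have hdyn : ∫ x, (h x - h (momentumFlip i (momentumFlip i' x))) ^ 2 ∂μ ≤ 4 * ε ^ 2 / C' :=
    hN₀ N i i' k hN₀N rfl rfl rfl s (by rw [hst]; exact ht1)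
  have hdyn0 : 0 ≤ ∫ x, (h x - h (momentumFlip i (momentumFlip i' x))) ^ 2 ∂μ :=
    integral_nonneg fun x => sq_nonneg _
  have hsq : (∫ x, P.bondCurrent N i x * h x ∂μ) ^ 2 ≤ ε ^ 2 := by
    have h1 : (∫ x, P.bondCurrent N i x ^ 2 ∂μ) * ∫ x, (h x - h (momentumFlip i (momentumFlip i' x))) ^ 2 ∂μ ≤
        C' * (4 * ε ^ 2 / C') :=
      mul_le_mul hstat hdyn hdyn0 hC'0.le
    rw [mul_div_cancel₀ _ hC'0.ne'] at h1
    nlinarith [hpair, h1]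
  rw [hentry]
  exact abs_le_of_sq_le_sq' hsq hε.le |>.elim (fun h1 h2 => abs_le.2 ⟨h1, h2⟩)

/-- **(FS) ⟹ the registered stub `stub_lightConeWindow`, verbatim**: the light-cone window of the extreme
Green–Kubo entry follows from the `L²(μ_T)` flip-insensitivity of the evolved far contact current ALONE (the static
input (S) is the landed `pinnedChain_integral_sq_bondCurrent_zero_le`; then `fixedTimeLocality_of_flipInsensitivity`
and the diagonal extraction `lightConeWindow_of_fixedTimeLocality`). [folklore] -/
theorem lightConeWindow_of_flipInsensitivity :
    (∀ ω₂ lam β γ : ℝ, 0 < ω₂ → 0 < lam → 0 < β → 0 < γ → ∀ T : ℝ, 0 < T → ∀ tstar ε : ℝ, 0 < ε →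
      ∃ N₀ : ℕ, ∀ (N : ℕ) (i i' k : Fin N), N₀ ≤ N → (i : ℕ) = 0 → (i' : ℕ) = 1 → (k : ℕ) = N - 2 →
        ∀ s : NNReal, (s : ℝ) ≤ tstar →
          ∫ x, ((∫ y, (pinnedChain ω₂ lam β γ).bondCurrent N k y
                  ∂((pinnedChain ω₂ lam β γ).transitionKernel N T T s x)) -
              (∫ y, (pinnedChain ω₂ lam β γ).bondCurrent N k y
                ∂((pinnedChain ω₂ lam β γ).transitionKernel N T T s (momentumFlip i (momentumFlip i' x))))) ^ 2
            ∂((pinnedChain ω₂ lam β γ).gibbsMeasure N T) ≤ ε) →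
    ∀ ω₂ lam β γ : ℝ, 0 < ω₂ → 0 < lam → 0 < β → 0 < γ → ∀ T : ℝ, 0 < T →
      ∃ t₀ η : ℕ → ℝ, (∀ N, 0 ≤ t₀ N) ∧ Tendsto t₀ atTop atTop ∧
        Tendsto (fun N => η N * t₀ N) atTop (𝓝 0) ∧
        ∀ N : ℕ, 2 ≤ N → ∀ t : ℝ, 0 ≤ t → t ≤ t₀ N →
          |gkEntry (pinnedChain ω₂ lam β γ) N T 0 (N - 2) t| ≤ η N :=
  fun hFS => lightConeWindow_of_fixedTimeLocality
    (fixedTimeLocality_of_flipInsensitivity pinnedChain_integral_sq_bondCurrent_zero_le hFS)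

end Summit.AtomisticToContinuum.FouriersLaw.Theorems.NonBallistic

end
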